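import Literature.MathematicalPhysics.QuantumFieldTheory.Balaban1983to89.BalabanAdmissibleClassParams
import Literature.MathematicalPhysics.QuantumFieldTheory.Balaban1983to89.T4AveragingDisintegration
import Summits.QuantumFields.YangMills.Theorems.FluctuationComparisonRegPrIntLOrganTangentTelescopeWindowPath
import Summits.QuantumFields.YangMills.Theorems.FluctuationComparisonRegPrIntLOrganTangentSmallStepOneBond
import Summits.QuantumFields.YangMills.Theorems.FluctuationComparisonRegPrIntLOrganTangentWindowGaugeInvariance
import Summits.QuantumFields.YangMills.Theorems.FluctuationComparisonRegPrIntLOrganTangentFlatAnchorEven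
import Summits.QuantumFields.YangMills.Theorems.FluctuationComparisonRegPrIntLOrganTangentSmallStepChordPath
import Summits.QuantumFields.YangMills.Theorems.FluctuationComparisonRegPrIntLOrganTangentAnchorFreeOscillation
import Literature.MathematicalPhysics.QuantumFieldTheory.Balaban1983to89.B15SU2ChartHolomorphic
import Literature.MathematicalPhysics.QuantumFieldTheory.Balaban1983to89.T4CubeChartExp
import Literature.MathematicalPhysics.QuantumFieldTheory.Balaban1983to89.T4ExpWindowSmallField
import Literature.MathematicalPhysics.QuantumFieldTheory.Balaban1983to89.T4SmallFieldWindowSandwich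
import Literature.MathematicalPhysics.QuantumFieldTheory.Balaban1983to89.T3InteriorExcision
import Literature.MathematicalPhysics.QuantumFieldTheory.Balaban1983to89.T3ThresholdSmallness
import Literature.MathematicalPhysics.QuantumFieldTheory.Balaban1983to89.T3PrintedMinimiserExistence
import Literature.MathematicalPhysics.QuantumFieldTheory.Balaban1983to89.T3MinimiserStabilityReduction
import HarnessLib

/-!
# Crux `FluctuationComparisonRegPrIntL` (stmt-QuantumFields-20520, rung R3), PATH-B organ, v18 (H-currency): THE JUNCTION `O1ᵘ-H v2 ⟹ S3ᴴ`,
# PART 1 (CORE) — helpers, the per-height core `supOsc_core`, and the assembly arithmetic (Theorems-side DEF-FREE LIFT of the ideator's crux file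
# `Cruxes/FluctuationComparisonRegPrIntL/JunctionDirectTransport.lean` v1.2, sha16 754f1386b6161105, §C–§E first half)

Cell `ym3-torus` (YM ladder rung R3 = continuum `SU(2)` Yang–Mills on the three-torus — a RUNG: NOT d = 4, NOT infinite volume, NOT a mass gap, NOT Clay).
AUTHOR of the mathematics and of every statement∕proof: ideator `ym-r3-idea-1` g27 (junction №4∕№6), over LEAD `ym-ust-20520-w3` g24's spec `V18-TYPING-SPEC-w3g24.md`
and bricks ✓p797413 (T), ✓p798086 (P-b′, w4 g22), ✓p799177 (TN-ANCHOR-FREE∕TN-OSC), ✓p794698∕✓p793256 (gauge invariance, flat evenness).  LIFTED to `Theorems/`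
by width seat `ym3-torus-px19` (gen 18) at text freeze (LEAD ■ FINAL 01:56Z «v18 texts FROZEN; px19 has the freeze ping»; LEAD №9 (B)∕№13∕№17, ★★OWNER №282∕№284∕№300):
`--kind proof --supports stmt-QuantumFields-20520 --as helper`, count-neutral; DEFINITION-FREE — the crux file's six `def`s (`sfCut`, `HClauseSq`, `AnalyticPairWindowAt`,
`SmallStepChordPath`, `OneStepTransportUH`, `BackwardStabilityFinSupH`) are INLINED at every use (implicit lattice indices as `_`), so `Lines/runpair_organ.lean` v18 can
close its S3ᴴ stub BY NAME through δ∕β∕ζ-unfolding of its own `def`s; statements and proofs otherwise VERBATIM (budget: default heartbeats, the five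
`linarith only` edits of v1.2).  Two files for the 400-line rule: this CORE and `…OrganTangentJunctionDirectTransport` (the junction theorem).

CONTENT (ns `Summit.QuantumFields.YangMills.Theorems.OrganTangentJunctionDirectTransportCore`): §C `sum_countP_fst_eq_length` · `dist1_expPt_le_sqrt3_mul_norm` ·
`letter_le_rowMass` · `rowMass_mono` · `θBal_div8`; §D `count_mul_sigma_le` (`n·σ ≤ 10·#PBond∕√θ`) · ★`supOsc_core` (OUTPUT `HClauseSq`-TEXT clause for a
gauge-invariant `R` + (P-b′)'s chord-path data at profile `b₀∕8` ⟹ `|R U − R 1| ≤ 150·K·#PBond_j²∕θ_j`, via ✓`OrganTangentAnchorFreeOscillation.osc_flat_window_path_le`);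
§E (first half) `assemble_lt` · `assemble_eq` (the real arithmetic of the two branches `j < T` ∕ `j = T`).

HONEST FRAMING: bookkeeping over HYPOTHESES (triangle inequalities, an induction, real arithmetic); nothing of Bałaban's analysis is asserted or
proved; O1ᵘ-H v2 (the binder `hO`, XL — the crux of the crux) and S1aᴴ are HYPOTHESES of the v18 line; S3ᴴ is proved FROM O1ᵘ-H v2 + (P-b′), nothing more;
O1∕O1ᵘ-H∕crux 20520 `FluctuationComparisonRegPrIntL`∕`YM3TorusSU2` are NOT proved; registry `Lines/semiclassical_s2beta.lean` v11.4 (★★OWNER RULING №36)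
and `Lines/runpair_organ.lean` v17.2 untouched by this file; rung R3 = SU(2) YM₃ on T³ at fixed lattice data — NOT d = 4, NOT infinite volume, NOT a mass
gap, NOT Clay; the Yang–Mills mass gap is NOT proved.

References: T. Bałaban, CMP **102** (1985) 255–275 [Balaban1985UV3] (p.263 (c)); CMP **109** (1987) 249–301 [Balaban1987RG1] ((0.4) p.253); CMP **116**
(1988) 1–22 [Balaban1988RG2] ((0.3)–(0.12)); CMP **98** (1985) 17–51 [Balaban1985Averaging] ((8), (11)–(13) p.19).
-/

set_option autoImplicit false

noncomputable section

open MeasureTheory Filter Topology Function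
open Literature.MathematicalPhysics.QuantumFieldTheory.Balaban1983to89 T3ContinuumYM3Torus T3NestedUnitLaws
  T3UnitLawDensityEML T4Continuum BalabanUVClass T3UnitScaleTilt
open T4CubeChartGnomonic (SU2)
open T4HaarSU2ExpChart (expPoint)
open T4CubeChartExp (expPt toE)
open B15SU2ChartHolomorphic (expPointC coe_expPoint_eq_expPointC)
open Summit.QuantumFields.YangMills.Theorems.OrganTangentTelescopeWindowPath (firstDiff_step_on clause_update_of_HClauseSq)
open Summit.QuantumFields.YangMills.Theorems.OrganTangentSmallStepOneBond (plaqDev_update_le)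
open scoped BigOperators

open Summit.QuantumFields.YangMills.Theorems.OrganTangentAnchorFreeOscillation

namespace Summit.QuantumFields.YangMills.Theorems.OrganTangentJunctionDirectTransportCore

/-! ## §C Small helpers -/

section Helpers

variable {α β : Type*} [Fintype α] [DecidableEq α]

/-- `∑_b #{steps at b} = #steps`. -/
theorem sum_countP_fst_eq_length (l : List (α × β)) :
    ∑ b, l.countP (fun q => decide (q.1 = b)) = l.length := by
  induction l with
  | nil => simp
  | cons a l ih =>
    simp only [List.countP_cons, List.length_cons, Finset.sum_add_distrib, ih]
    have : ∑ b : α, (if decide (a.1 = b) = true then 1 else 0) = 1 := by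
      simp [Finset.sum_ite_eq]
    omega

end Helpers

/-- `dist1 (expPt v) ≤ √3·‖v‖` (sup-norm coordinates). -/
theorem dist1_expPt_le_sqrt3_mul_norm (v : Fin 3 → ℝ) : dist1 (expPt v) ≤ Real.sqrt 3 * ‖v‖ :=
  T4ExpWindowSmallField.dist1_expPt_le_of_mem_cube (T4CubePoincare.mem_cube_iff.2 fun i => by
    rw [← Real.norm_eq_abs]; exact norm_le_pi_norm v i)

/-- A row-mass bound dominates every letter: `0 ≤ k`, `κ ≥ 0` ⇒ `k b b′ ≤ ∑_{b″} k b b″·e^{κ d} ≤ w`. -/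
theorem letter_le_rowMass {P : Params} {j : ℕ} {k : PBond P j → PBond P j → ℝ} {κ w : ℝ} (hκ : 0 ≤ κ)
    (hk : ∀ b b', 0 ≤ k b b') (hrow : ∀ b, ∑ b', k b b' * Real.exp (κ * (b.src.tdist b'.src : ℝ)) ≤ w) (b b' : PBond P j) :
    k b b' ≤ w := by
  have h1 : k b b' ≤ k b b' * Real.exp (κ * (b.src.tdist b'.src : ℝ)) :=
    le_mul_of_one_le_right (hk b b') (Real.one_le_exp (mul_nonneg hκ (Nat.cast_nonneg _)))
  have h2 : k b b' * Real.exp (κ * (b.src.tdist b'.src : ℝ)) ≤ ∑ b'', k b b'' * Real.exp (κ * (b.src.tdist b''.src : ℝ)) :=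
    Finset.single_le_sum (f := fun b'' => k b b'' * Real.exp (κ * (b.src.tdist b''.src : ℝ)))
      (fun b'' _ => mul_nonneg (hk b b'') (Real.exp_nonneg _)) (Finset.mem_univ b')
  exact h1.trans (h2.trans (hrow b))

/-- Row-mass bounds are monotone in the rate: `κ′ ≤ κ` ⇒ `∑ k·e^{κ′d} ≤ ∑ k·e^{κd} ≤ w`. -/
theorem rowMass_mono {P : Params} {j : ℕ} {k : PBond P j → PBond P j → ℝ} {κ κ' w : ℝ} (hκ : κ' ≤ κ)
    (hk : ∀ b b', 0 ≤ k b b') (hrow : ∀ b, ∑ b', k b b' * Real.exp (κ * (b.src.tdist b'.src : ℝ)) ≤ w) (b : PBond P j) :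
    ∑ b', k b b' * Real.exp (κ' * (b.src.tdist b'.src : ℝ)) ≤ w := by
  refine (Finset.sum_le_sum fun b' _ => ?_).trans (hrow b)
  exact mul_le_mul_of_nonneg_left (Real.exp_le_exp.2 (mul_le_mul_of_nonneg_right hκ (Nat.cast_nonneg _))) (hk b b')

/-- `θBal` is linear in `b₀`: the path profile `b₀∕8`. -/
theorem θBal_div8 (L : ℕ) (γ b₀ p₀ : ℝ) (i : ℕ) : θBal L γ (b₀ / 8) p₀ i = θBal L γ b₀ p₀ i / 8 := by
  rw [show b₀ / 8 = (1 / 8) * b₀ by ring, T3InteriorExcision.θBal_mul]; ring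


/-! ## §D The per-height core: OUTPUT clause + gauge invariance + (P-b′)'s chord path ⇒ sup-oscillation of the clause's `R` -/

section Core

open Summit.QuantumFields.YangMills.Theorems.OrganTangentFlatAnchorEven (flatBond_apply_inv_eq)

/-- Count arithmetic: (P-b′) v1.1's per-bond multiplicity at path profile `θ∕8` with step `δ := σ·θ∕4`, times `σ`, is `≤ 10∕√θ`
(`θ ≤ 1`, `σ ≤ 1∕16`, `π ≤ 4`). -/
theorem count_mul_sigma_le {θ σ : ℝ} (hθ : 0 < θ) (hθ1 : θ ≤ 1) (hσ : 0 < σ) (hσ1 : σ ≤ 1 / 16) :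
    ((⌈1 / (Real.sqrt (θ / 8) / 16)⌉₊ *
        (⌈Real.pi / 2 * (3 * (Real.sqrt (θ / 8) / 16) ^ 2 / 2) / (σ * (θ / 4))⌉₊ + 2) : ℕ) : ℝ) * σ ≤ 10 / Real.sqrt θ := by
  have hs0 : 0 < Real.sqrt (θ / 8) := Real.sqrt_pos.2 (by positivity)
  have hs2 : Real.sqrt (θ / 8) ^ 2 = θ / 8 := Real.sq_sqrt (by positivity)
  have ht0 : 0 < Real.sqrt θ := Real.sqrt_pos.2 hθ
  have ht1 : Real.sqrt θ ≤ 1 := Real.sqrt_le_one.mpr hθ1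
  have h3s : Real.sqrt θ ≤ 3 * Real.sqrt (θ / 8) := by
    have h := Real.sqrt_le_sqrt (show θ ≤ 9 * (θ / 8) by linarith)
    rwa [Real.sqrt_mul (by norm_num : (0:ℝ) ≤ 9), show Real.sqrt 9 = 3 by
      rw [show (9:ℝ) = 3 ^ 2 by norm_num, Real.sqrt_sq (by norm_num : (0:ℝ) ≤ 3)]] at h
  -- first factor `⌈16∕s⌉₊ ≤ 49∕√θ`
  have hA : (⌈1 / (Real.sqrt (θ / 8) / 16)⌉₊ : ℝ) ≤ 49 / Real.sqrt θ := by
    have hx : 0 ≤ 1 / (Real.sqrt (θ / 8) / 16) := by positivity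
    have h1 := Nat.ceil_lt_add_one hx
    have h2 : 1 / (Real.sqrt (θ / 8) / 16) ≤ 48 / Real.sqrt θ := by
      rw [div_div_eq_mul_div, one_mul, div_le_div_iff₀ hs0 ht0]
      nlinarith [h3s]
    have h3 : (1:ℝ) ≤ 1 / Real.sqrt θ := by rw [le_div_iff₀ ht0]; linarith
    calc (⌈1 / (Real.sqrt (θ / 8) / 16)⌉₊ : ℝ) ≤ 1 / (Real.sqrt (θ / 8) / 16) + 1 := h1.le
      _ ≤ 48 / Real.sqrt θ + 1 / Real.sqrt θ := add_le_add h2 h3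
      _ = 49 / Real.sqrt θ := by ring
  -- second factor times `σ`: `(⌈3π∕(2048σ)⌉₊ + 2)·σ ≤ 1∕5`
  have hq : Real.pi / 2 * (3 * (Real.sqrt (θ / 8) / 16) ^ 2 / 2) / (σ * (θ / 4)) = 3 * Real.pi / (2048 * σ) := by
    rw [div_pow, hs2]; field_simp; ring
  have hB : ((⌈Real.pi / 2 * (3 * (Real.sqrt (θ / 8) / 16) ^ 2 / 2) / (σ * (θ / 4))⌉₊ : ℝ) + 2) * σ ≤ 1 / 5 := by
    rw [hq]
    have hx : 0 ≤ 3 * Real.pi / (2048 * σ) := by positivity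
    have h1 := Nat.ceil_lt_add_one hx
    have hpi := Real.pi_le_four
    calc ((⌈3 * Real.pi / (2048 * σ)⌉₊ : ℝ) + 2) * σ ≤ (3 * Real.pi / (2048 * σ) + 1 + 2) * σ := by
          apply mul_le_mul_of_nonneg_right _ hσ.le; linarith
      _ = 3 * Real.pi / 2048 + 3 * σ := by field_simp; ring
      _ ≤ 1 / 5 := by nlinarith
  push_cast
  calc (⌈1 / (Real.sqrt (θ / 8) / 16)⌉₊ : ℝ) *
        ((⌈Real.pi / 2 * (3 * (Real.sqrt (θ / 8) / 16) ^ 2 / 2) / (σ * (θ / 4))⌉₊ : ℝ) + 2) * σ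
      = (⌈1 / (Real.sqrt (θ / 8) / 16)⌉₊ : ℝ) *
        (((⌈Real.pi / 2 * (3 * (Real.sqrt (θ / 8) / 16) ^ 2 / 2) / (σ * (θ / 4))⌉₊ : ℝ) + 2) * σ) := by ring
    _ ≤ 49 / Real.sqrt θ * (1 / 5) := mul_le_mul hA hB (by positivity) (by positivity)
    _ ≤ 10 / Real.sqrt θ := by rw [div_mul_div_comm, div_le_div_iff₀ (by positivity) ht0]; nlinarith

variable {F : T3Family} {γ b₀ p₀ : ℝ} {j : ℕ}

/-- ★ THE PER-HEIGHT CORE.  An H-clause for a gauge-invariant `R` on the `θ_j∕4`-window with cap `rr` and letters `k ≤ K`, and (P-b′)'s chord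
path at profile `b₀∕8` with step `σ·θ_j∕4` (`σ ≤ rr`, `σ ≤ 1∕16`, `θ_j ≤ 1`) from `1` to a gauge copy of `U`, give
`|R U − R 1| ≤ 150·K·#PBond_j²∕θ_j` (TN-ANCHOR-FREE + TN-OSC: `osc_flat_window_path_le`, `n·σ ≤ 10·#PBond_j∕√θ_j`). [bookkeeping] -/
theorem supOsc_core [DecidableEq (PBond (F.P j) 0)]
    (hθ : 0 < θBal F.L γ b₀ p₀ j) (hθ1 : θBal F.L γ b₀ p₀ j ≤ 1)
    {rr K σ : ℝ} (hK : 0 ≤ K) (hσ : 0 < σ) (hσr : σ ≤ rr) (hσ1 : σ ≤ 1 / 16)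
    {k : PBond (F.P j) 0 → PBond (F.P j) 0 → ℝ} {R : GaugeField (F.P j) 0 SU2 → ℝ}
    (hk : ∀ b b', 0 ≤ k b b' ∧ k b b' ≤ K)
    (hcl : (∀ (b b' : PBond _ _) (v v' : Fin 3 → ℝ) (U V W Z : GaugeField _ _ ↥(Matrix.specialUnitaryGroup (Fin 2) ℂ)), ‖v‖ ≤ rr * (θBal F.L γ b₀ p₀ j / 4) → ‖v'‖ ≤ rr * (θBal F.L γ b₀ p₀ j / 4) → PlaqSmall (θBal F.L γ b₀ p₀ j / 4) U → PlaqSmall (θBal F.L γ b₀ p₀ j / 4) V → PlaqSmall (θBal F.L γ b₀ p₀ j / 4) W → PlaqSmall (θBal F.L γ b₀ p₀ j / 4) Z → (∀ e, e ≠ b → V e = U e) → V b = U b * expPt v → (∀ e, e ≠ b' → W e = U e) → W b' = U b' * expPt v' → (∀ e, e ≠ b' → Z e = V e) → Z b' = V b' * expPt v' → |R Z - R V - R W + R U| ≤ k b b' * (‖v‖ / (θBal F.L γ b₀ p₀ j / 4)) * (‖v'‖ / (θBal F.L γ b₀ p₀ j / 4)))) (hinv : GaugeField.GaugeInvariant 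R)
    (U : GaugeField (F.P j) 0 SU2) (u : GaugeTransf (F.P j) 0 SU2) (path : List (PBond (F.P j) 0 × (Fin 3 → ℝ)))
    (hsz : ∀ q ∈ path, ‖q.2‖ ≤ σ * (θBal F.L γ b₀ p₀ j / 4))
    (hcount : ∀ b : PBond (F.P j) 0, path.countP (fun q => decide (q.1 = b)) ≤
      ⌈1 / (Real.sqrt (θBal F.L γ (b₀ / 8) p₀ j) / 16)⌉₊ *
        (⌈Real.pi / 2 * (3 * (Real.sqrt (θBal F.L γ (b₀ / 8) p₀ j) / 16) ^ 2 / 2) / (σ * (θBal F.L γ b₀ p₀ j / 4))⌉₊ + 2))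
    (hend : List.foldl (fun (W : GaugeField (F.P j) 0 SU2) (q : PBond (F.P j) 0 × (Fin 3 → ℝ)) => update W q.1 (W q.1 * expPt q.2)) 1 path =
      GaugeField.gaugeAct u U)
    (hpre : ∀ m : ℕ, m ≤ path.length → PlaqSmall (θBal F.L γ (b₀ / 8) p₀ j)
      (List.foldl (fun (W : GaugeField (F.P j) 0 SU2) (q : PBond (F.P j) 0 × (Fin 3 → ℝ)) => update W q.1 (W q.1 * expPt q.2)) 1 (path.take m)))
    (hexc : ∀ m : ℕ, m ≤ path.length → ∀ (b : PBond (F.P j) 0) (w : Fin 3 → ℝ),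
      PlaqSmall (θBal F.L γ (b₀ / 8) p₀ j + 4 * dist1 (expPt w))
        (update (List.foldl (fun (W : GaugeField (F.P j) 0 SU2) (q : PBond (F.P j) 0 × (Fin 3 → ℝ)) => update W q.1 (W q.1 * expPt q.2)) 1 (path.take m)) b
          ((List.foldl (fun (W : GaugeField (F.P j) 0 SU2) (q : PBond (F.P j) 0 × (Fin 3 → ℝ)) => update W q.1 (W q.1 * expPt q.2)) 1 (path.take m)) b *
            expPt w))) :
    |R U - R 1| ≤ 150 * K * (Fintype.card (PBond (F.P j) 0) : ℝ) ^ 2 / θBal F.L γ b₀ p₀ j := by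
  have h8 : θBal F.L γ (b₀ / 8) p₀ j = θBal F.L γ b₀ p₀ j / 8 := θBal_div8 F.L γ b₀ p₀ j
  rw [h8] at hcount hpre hexc
  set θj := θBal F.L γ b₀ p₀ j with hθj
  have hθW : 0 < θj / 4 := by positivity
  -- `R U = R (U^u) = R (end of the path)`
  have hRU : R U = R (List.foldl (fun (W : GaugeField (F.P j) 0 SU2) (q : PBond (F.P j) 0 × (Fin 3 → ℝ)) =>
      update W q.1 (W q.1 * expPt q.2)) 1 path) := by rw [hend, hinv u U]
  have hinv' : ∀ (b : PBond (F.P j) 0) (g : SU2), R (update 1 b g⁻¹) = R (update 1 b g) := fun b g => flatBond_apply_inv_eq hinv b g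
  have hk' : ∀ p ∈ path, ∀ q ∈ path, 0 ≤ k p.1 q.1 ∧ k p.1 q.1 ≤ K := fun p _ q _ => hk p.1 q.1
  have hsz' : ∀ q ∈ path, ‖q.2‖ / (θj / 4) ≤ σ := fun q hq => by rw [div_le_iff₀ hθW]; exact hsz q hq
  have hs3 : Real.sqrt 3 ≤ 2 := by
    rw [show (2:ℝ) = Real.sqrt 4 by rw [show (4:ℝ) = 2 ^ 2 by norm_num, Real.sqrt_sq (by norm_num : (0:ℝ) ≤ 2)]]
    exact Real.sqrt_le_sqrt (by norm_num)
  have hd3 : ∀ q ∈ path, 4 * dist1 (expPt q.2) ≤ θj / 8 := by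
    intro q hq
    have h3 : dist1 (expPt q.2) ≤ 2 * (σ * (θj / 4)) :=
      (dist1_expPt_le_sqrt3_mul_norm q.2).trans (mul_le_mul hs3 (hsz q hq) (norm_nonneg _) (by norm_num))
    nlinarith [hσ1, hθ]
  have hdist : ∀ q ∈ path, dist1 (expPt q.2) < θj / 4 := fun q hq => by
    have := hd3 q hq; nlinarith [GaugeGroup.dist1_nonneg (expPt q.2), hθ]
  have hgood : ∀ n ≤ path.length,
      PlaqSmall (θj / 4) ((path.take n).foldl (fun U p => update U p.1 (U p.1 * expPt p.2)) (1 : GaugeField (F.P j) 0 SU2)) ∧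
      ∀ q ∈ path, PlaqSmall (θj / 4) (update ((path.take n).foldl (fun U p => update U p.1 (U p.1 * expPt p.2)) (1 : GaugeField (F.P j) 0 SU2)) q.1
        (((path.take n).foldl (fun U p => update U p.1 (U p.1 * expPt p.2)) (1 : GaugeField (F.P j) 0 SU2)) q.1 * expPt q.2)) := by
    intro n hn
    exact ⟨T3PrintedMinimiserExistence.plaqSmall_of_le (by linarith) (hpre n hn),
      fun q hq => T3PrintedMinimiserExistence.plaqSmall_of_le (by linarith [hd3 q hq]) (hexc n hn q.1 q.2)⟩
  have hosc := osc_flat_window_path_le hθW hcl hinv' hK hσ.le hσr path hk' hsz' hdist hgood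
  -- length: `n ≤ #PBond·N`, `N·σ ≤ 10∕√θ_j`
  set n := path.length with hn
  have hlen : (n : ℝ) * σ ≤ (Fintype.card (PBond (F.P j) 0) : ℝ) * (10 / Real.sqrt θj) := by
    have hsum := sum_countP_fst_eq_length path
    have h1 : n ≤ Fintype.card (PBond (F.P j) 0) * (⌈1 / (Real.sqrt (θj / 8) / 16)⌉₊ *
        (⌈Real.pi / 2 * (3 * (Real.sqrt (θj / 8) / 16) ^ 2 / 2) / (σ * (θj / 4))⌉₊ + 2)) := by
      rw [hn, ← hsum]
      calc ∑ b, path.countP (fun q => decide (q.1 = b))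
          ≤ ∑ _b : PBond (F.P j) 0, ⌈1 / (Real.sqrt (θj / 8) / 16)⌉₊ *
              (⌈Real.pi / 2 * (3 * (Real.sqrt (θj / 8) / 16) ^ 2 / 2) / (σ * (θj / 4))⌉₊ + 2) := Finset.sum_le_sum fun b _ => hcount b
        _ = _ := by rw [Finset.sum_const, smul_eq_mul, Finset.card_univ]
    have h2 := count_mul_sigma_le hθ hθ1 hσ hσ1
    calc (n : ℝ) * σ ≤ ((Fintype.card (PBond (F.P j) 0) * (⌈1 / (Real.sqrt (θj / 8) / 16)⌉₊ *
        (⌈Real.pi / 2 * (3 * (Real.sqrt (θj / 8) / 16) ^ 2 / 2) / (σ * (θj / 4))⌉₊ + 2)) : ℕ) : ℝ) * σ :=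
          mul_le_mul_of_nonneg_right (by exact_mod_cast h1) hσ.le
      _ = (Fintype.card (PBond (F.P j) 0) : ℝ) * (((⌈1 / (Real.sqrt (θj / 8) / 16)⌉₊ *
        (⌈Real.pi / 2 * (3 * (Real.sqrt (θj / 8) / 16) ^ 2 / 2) / (σ * (θj / 4))⌉₊ + 2) : ℕ) : ℝ) * σ) := by push_cast; ring
      _ ≤ (Fintype.card (PBond (F.P j) 0) : ℝ) * (10 / Real.sqrt θj) := mul_le_mul_of_nonneg_left h2 (Nat.cast_nonneg _)
  have hsq : ((n : ℝ) * σ) ^ 2 ≤ (Fintype.card (PBond (F.P j) 0) : ℝ) ^ 2 * (100 / θj) := by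
    have h0 : 0 ≤ (n : ℝ) * σ := by positivity
    calc ((n : ℝ) * σ) ^ 2 ≤ ((Fintype.card (PBond (F.P j) 0) : ℝ) * (10 / Real.sqrt θj)) ^ 2 := pow_le_pow_left₀ h0 hlen 2
      _ = (Fintype.card (PBond (F.P j) 0) : ℝ) ^ 2 * (100 / θj) := by rw [mul_pow, div_pow, Real.sq_sqrt hθ.le]; norm_num
  rw [hRU]
  refine hosc.trans ?_
  rcases Nat.eq_zero_or_pos n with hn0 | hn1
  · rw [hn0]; simp only [Nat.cast_zero, zero_mul]; positivity
  · have hσn : σ ≤ (n : ℝ) * σ := le_mul_of_one_le_left hσ.le (by exact_mod_cast hn1)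
    have hsplit : (n : ℝ) * (K * σ / 2 + (n : ℝ) * (K * σ)) * σ = K / 2 * (((n : ℝ) * σ) * σ) + K * ((n : ℝ) * σ) ^ 2 := by ring
    rw [hsplit]
    have hKn : K / 2 * (((n : ℝ) * σ) * σ) ≤ K / 2 * ((n : ℝ) * σ) ^ 2 := by
      refine mul_le_mul_of_nonneg_left ?_ (by positivity)
      rw [sq]; exact mul_le_mul_of_nonneg_left hσn (by positivity)
    calc K / 2 * (((n : ℝ) * σ) * σ) + K * ((n : ℝ) * σ) ^ 2 ≤ K / 2 * ((n : ℝ) * σ) ^ 2 + K * ((n : ℝ) * σ) ^ 2 := add_le_add hKn le_rfl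
      _ = 3 / 2 * K * ((n : ℝ) * σ) ^ 2 := by ring
      _ ≤ 3 / 2 * K * ((Fintype.card (PBond (F.P j) 0) : ℝ) ^ 2 * (100 / θj)) := mul_le_mul_of_nonneg_left hsq (by positivity)
      _ = 150 * K * (Fintype.card (PBond (F.P j) 0) : ℝ) ^ 2 / θj := by ring

end Core

/-! ## §E The junction `directTransport_supR : O1ᵘ-H v2 → (P-b′) → S3ᴴ` -/

/-- Pure arithmetic of the `j < T` assembly. -/
theorem assemble_lt {θ M A xT δj Y a' w' βj θj NP NB core marg : ℝ}
    (hθ : 0 < θ) (hM : M = 150 / θ + 150) (hβj : 0 < βj) (hθj : 0 < θj) (hθj1 : θj ≤ 1) (hNP : 0 ≤ NP)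
    (ha' : 0 ≤ a') (haY : a' ≤ Y) (hwY : θ * w' ≤ Y * (βj * θj ^ 2)) (hYA : Y ≤ A * xT + δj)
    (hcore : core ≤ 150 * w' * NB ^ 2 / θj) (hmarg : marg ≤ βj * (2 * NP) * a') :
    core + marg ≤ (M * A * xT + M * δj) * (βj * (2 * NP + NB ^ 2)) := by
  have hY0 : 0 ≤ Y := ha'.trans haY
  have hMθ : 0 ≤ 150 / θ := by positivity
  have hM1 : 150 / θ ≤ M := by rw [hM]; linarith
  have hM2 : 1 ≤ M := by rw [hM]; linarith
  have hM0 : 0 ≤ M := zero_le_one.trans hM2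
  have hw' : w' ≤ Y * (βj * θj ^ 2) / θ := by rw [le_div_iff₀ hθ]; linarith
  have h1 : core ≤ M * Y * (βj * NB ^ 2) := by
    refine hcore.trans ?_
    have h2 : 150 * w' * NB ^ 2 / θj ≤ 150 * (Y * (βj * θj ^ 2) / θ) * NB ^ 2 / θj := by gcongr
    refine h2.trans ?_
    have e : 150 * (Y * (βj * θj ^ 2) / θ) * NB ^ 2 / θj = (150 / θ) * Y * (βj * NB ^ 2) * θj := by
      field_simp
    rw [e]
    have h3 : (150 / θ) * Y * (βj * NB ^ 2) * θj ≤ (150 / θ) * Y * (βj * NB ^ 2) * 1 :=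
      mul_le_mul_of_nonneg_left hθj1 (by positivity)
    rw [mul_one] at h3
    exact h3.trans (mul_le_mul_of_nonneg_right (mul_le_mul_of_nonneg_right hM1 hY0) (by positivity))
  have h2 : marg ≤ M * Y * (βj * (2 * NP)) := by
    refine hmarg.trans ?_
    have h3 : βj * (2 * NP) * a' ≤ βj * (2 * NP) * Y := mul_le_mul_of_nonneg_left haY (by positivity)
    refine h3.trans ?_
    rw [mul_comm (βj * (2 * NP)) Y, mul_assoc]
    exact le_mul_of_one_le_left (by positivity) hM2
  have h3 : M * Y * (βj * NB ^ 2) + M * Y * (βj * (2 * NP)) = M * Y * (βj * (2 * NP + NB ^ 2)) := by ring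
  have h4 : M * Y * (βj * (2 * NP + NB ^ 2)) ≤ M * (A * xT + δj) * (βj * (2 * NP + NB ^ 2)) :=
    mul_le_mul_of_nonneg_right (mul_le_mul_of_nonneg_left hYA hM0) (by positivity)
  calc core + marg ≤ M * Y * (βj * NB ^ 2) + M * Y * (βj * (2 * NP)) := add_le_add h1 h2
    _ = M * Y * (βj * (2 * NP + NB ^ 2)) := h3
    _ ≤ M * (A * xT + δj) * (βj * (2 * NP + NB ^ 2)) := h4
    _ = (M * A * xT + M * δj) * (βj * (2 * NP + NB ^ 2)) := by ring

/-- Pure arithmetic of the `j = T` assembly. -/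
theorem assemble_eq {θ M A xT δj wT βj θj NP NB core : ℝ}
    (hθ : 0 < θ) (hM : M = 150 / θ + 150) (hA1 : 1 ≤ A) (hδ : 0 ≤ δj) (hxT : 0 ≤ xT) (hβj : 0 < βj) (hθj : 0 < θj)
    (hθj1 : θj ≤ 1) (hNP : 0 ≤ NP) (hwx : wT = xT * (βj * θj ^ 2)) (hcore : core ≤ 150 * wT * NB ^ 2 / θj) :
    core ≤ (M * A * xT + M * δj) * (βj * (2 * NP + NB ^ 2)) := by
  have hMθ : 0 ≤ 150 / θ := by positivity
  have hM150 : 150 ≤ M := by rw [hM]; linarith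
  have hM0 : 0 ≤ M := le_trans (by norm_num) hM150
  have hMA : 150 ≤ M * A := by nlinarith
  refine hcore.trans ?_
  have e : 150 * wT * NB ^ 2 / θj = 150 * xT * (βj * NB ^ 2) * θj := by rw [hwx]; field_simp
  rw [e]
  have h1 : 150 * xT * (βj * NB ^ 2) * θj ≤ 150 * xT * (βj * NB ^ 2) * 1 := mul_le_mul_of_nonneg_left hθj1 (by positivity)
  rw [mul_one] at h1
  refine h1.trans ?_
  calc 150 * xT * (βj * NB ^ 2) ≤ (M * A) * xT * (βj * NB ^ 2) := by gcongr
    _ ≤ (M * A * xT + M * δj) * (βj * NB ^ 2) := by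
        apply mul_le_mul_of_nonneg_right _ (by positivity); nlinarith
    _ ≤ (M * A * xT + M * δj) * (βj * (2 * NP + NB ^ 2)) := by
        apply mul_le_mul_of_nonneg_left _ (by positivity)
        apply mul_le_mul_of_nonneg_left _ hβj.le
        nlinarith

end Summit.QuantumFields.YangMills.Theorems.OrganTangentJunctionDirectTransportCore

end
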